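import Summits.CriticalPhenomena.CardyFormulaZ2.Theorems.CardyUSTContinuationSmallFugacityLimitContinuumChecks

/-!
# `SmallFugacityLimit` (crux stmt-CriticalPhenomena-6048), line `registered`: stub `stub_unitInterval`

The jointly-wired self-dual FK(`p = t/(1+t)`, `q = t²`) crossing probability `uJ R t δ` of G02's
discretisation of a conformal rectangle lies in `[0, 1]` for every `R`, every mesh `δ` and every
`t > 0`: for `δ > 0` the domain random-cluster measure `fkDomainMeasure` is a probability measure
(`isProbabilityMeasure_fkDomainMeasure`, since `t/(1+t) ∈ [0,1]` and `t² > 0`), so `Measure.real` of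
the crossing event is in `[0, 1]`; for `δ ≤ 0` the junk value is `0 ∈ [0, 1]`.
This is the provable (precompactness) half of the existence storey of the crux.
[cite: Grimmett2006, §1.2]
-/

noncomputable section

namespace Summit.CriticalPhenomena.CardyFormulaZ2.Theorems

namespace SmallFugacityContinuum

open Set
open Literature.Probability.RandomPlanarGeometry (ConformalRectangle)
open Literature.Probability.LatticeModels (fkDomainMeasure meshDomain_finite
  isProbabilityMeasure_fkDomainMeasure)
open Literature.Probability.Percolation (discreteCrossing)

/-- **Stub `stub_unitInterval`.** The jointly-wired self-dual FK(`p = t/(1+t)`, `q = t²`) crossing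
probabilities are genuine probabilities: `uJ R t δ ∈ [0, 1]` for every conformal rectangle `R`,
every `δ` and every `t > 0` (for `δ > 0`, `fkDomainMeasure` is a probability measure because
`t/(1+t) ∈ [0, 1]` and `0 < t²`; for `δ ≤ 0` the junk value `0` lies in `[0, 1]`).
[cite: Grimmett2006, §1.2] -/
theorem stub_unitInterval :
    ∀ (R : ConformalRectangle) (t δ : ℝ), 0 < t → uJ R t δ ∈ Set.Icc (0:ℝ) 1 := by
  intro R t δ ht
  simp only [uJ]
  split_ifs with h
  · have hp : t / (1 + t) ∈ Set.Icc (0:ℝ) 1 :=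
      ⟨div_nonneg ht.le (by linarith), (div_le_one (by linarith)).2 (by linarith)⟩
    have hq : (0:ℝ) < t ^ 2 := by positivity
    haveI := @isProbabilityMeasure_fkDomainMeasure R.carrier δ _ _ hp hq (R.arc 0 ∪ R.arc 2)
      (meshDomain_finite R.isBounded h).fintype
    exact ⟨MeasureTheory.measureReal_nonneg, MeasureTheory.measureReal_le_one⟩
  · exact ⟨le_rfl, zero_le_one⟩

end SmallFugacityContinuum

end Summit.CriticalPhenomena.CardyFormulaZ2.Theorems

end
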